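import Summits.AtomisticToContinuum.FouriersLaw.Theorems.BondHeatUncertaintyExtensiveSnapshotIrreversibilityEnergyWindowCostateFloor
import HarnessLib

/-!
# Bond heat uncertainty — energy window: the HARMONIC CALIBRATION of the costate
  observability floor (COF)

Cell `decomp-a2c`, lens-1 «grading / quantitative ladder», generation 84, crux
`stmt-AtomisticToContinuum-9121` (`ExtensiveSnapshotIrreversibility`, K_fix half, leaf S3), part L.
Parts I–K left the binder of record (MC∞) `SkeletonGramLimitInverseMoments` resting on ONE
measure-free leaf, (COF) `CostateObservabilityFloor` (part J): along every driven path and for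
every path costate `c` on `[0, s]`,
`⟨c(s), c(s)⟩ ≤ K_θ · Θ_θ^μ · ∫₀ˢ β_0(r)² dr`.
This file DECIDES (COF) for the harmonic chain `lam = β = 0` (every `N ≥ 2`, `ω₂, γ > 0`), with
`μ = 1` and a `θ`-independent constant:

* `harmonic_pathCostate_eq` — **uniqueness**: a path costate of the harmonic chain (constant
  co-drift `𝒢`, tree `harmonic_coDrift_eq`) is the harmonic costate `exp((r - s)𝒢) c(s)` through
  its terminal value (the conjugated curve `exp(-r𝒢) c(r)` has zero derivative on `(0, s)` and is
  continuous on `[0, s]`);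
* `harmonic_costateObservabilityFloorBody` — (COF) at `(ω₂, 0, 0, γ)` from the tree's Kalman
  observability of the harmonic costate through the left-bath momentum on `[0, ½]`
  (`harmonic_costate_observability`, `harmonic_costate_energy_ge`, node «SkeletonGramFloor») and
  `Θ_θ ≥ 1` (`one_le_energyBudget`).

So the record leaf has the right shape: it is decided in the Gaussian model, exactly as (EBF),
(MC∞), (MC⁰) were (parts I-B, g83).  No measure theory is used.

References: tree `…EnergyWindowHarmonicLinearisation` (`harmCostate`, `harmonic_coDrift_eq`),
`…EnergyWindowSkeletonGramFloor` §3, `Literature/Analysis/ODE/LinearObservability`.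
-/

namespace Summit.AtomisticToContinuum.FouriersLaw.Theorems.ExtensiveSnapshotIrreversibility.EnergyWindow

open MeasureTheory Filter Topology Set NormedSpace
open scoped ENNReal NNReal
open Literature.MathematicalPhysics.KineticTheory.HeatConduction Literature.Probability.Process
open Literature.Analysis.ODE

/-! ## 1. The self-pairing against the sup norm -/

section PairBound

variable (N : ℕ)

/-- `⟨c, c⟩ ≤ 2N ‖c‖²`: the self-pairing is a sum of `2N` squared coordinates, each at most the
squared sup norm of the phase-space point. [folklore] -/
theorem dualPair_self_le (c : PhaseSpace N) : dualPair c c ≤ 2 * N * ‖c‖ ^ 2 := by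
  have h1 : ∀ i, c.1 i * c.1 i ≤ ‖c‖ ^ 2 := fun i => by
    have hi : ‖c.1 i‖ ≤ ‖c‖ := (norm_le_pi_norm c.1 i).trans (norm_fst_le c)
    rw [Real.norm_eq_abs] at hi
    rw [← sq, ← sq_abs]
    exact pow_le_pow_left₀ (abs_nonneg _) hi 2
  have h2 : ∀ i, c.2 i * c.2 i ≤ ‖c‖ ^ 2 := fun i => by
    have hi : ‖c.2 i‖ ≤ ‖c‖ := (norm_le_pi_norm c.2 i).trans (norm_snd_le c)
    rw [Real.norm_eq_abs] at hi
    rw [← sq, ← sq_abs]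
    exact pow_le_pow_left₀ (abs_nonneg _) hi 2
  unfold dualPair
  calc ∑ i, c.1 i * c.1 i + ∑ i, c.2 i * c.2 i
      ≤ ∑ _i : Fin N, ‖c‖ ^ 2 + ∑ _i : Fin N, ‖c‖ ^ 2 :=
        add_le_add (Finset.sum_le_sum fun i _ => h1 i) (Finset.sum_le_sum fun i _ => h2 i)
    _ = 2 * N * ‖c‖ ^ 2 := by
        simp only [Finset.sum_const, Finset.card_univ, Fintype.card_fin, nsmul_eq_mul]
        ring

end PairBound

/-! ## 2. Uniqueness of path costates of the harmonic chain -/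

section Uniqueness

variable (ω₂ γ : ℝ) (N : ℕ)

/-- The conjugated costate `e(r) = exp(r · (-𝒢)) c(r)` of a path costate of the harmonic chain has
zero derivative on `(0, s)` (`d/dr exp(r(-𝒢)) = exp(r(-𝒢)) (-𝒢)` and `ċ = 𝒢 c`). [folklore] -/
theorem hasDerivAt_conj_pathCostate {T_L T_R s : ℝ} {z : PhaseSpace N} {wp : WienerPair}
    {c : ℝ → PhaseSpace N} (hc : IsPathCostate ω₂ 0 0 γ N T_L T_R s z wp c) {r : ℝ}
    (hr : r ∈ Ioo 0 s) :
    HasDerivAt (fun u : ℝ => exp (u • (-harmCoDriftLin ω₂ γ N)) (c u)) 0 r := by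
  have h1 := hasDerivAt_exp_smul_const (𝕂 := ℝ) (-harmCoDriftLin ω₂ γ N) r
  have h2 : HasDerivAt c (harmCoDriftLin ω₂ γ N (c r)) r := by
    have h := hc.2 r hr
    rwa [harmonic_coDrift_eq] at h
  have h := h1.clm_apply h2
  have h0 : (exp (r • (-harmCoDriftLin ω₂ γ N)) * (-harmCoDriftLin ω₂ γ N)) (c r) +
      exp (r • (-harmCoDriftLin ω₂ γ N)) (harmCoDriftLin ω₂ γ N (c r)) = 0 := by
    change exp (r • (-harmCoDriftLin ω₂ γ N)) (-(harmCoDriftLin ω₂ γ N (c r))) +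
      exp (r • (-harmCoDriftLin ω₂ γ N)) (harmCoDriftLin ω₂ γ N (c r)) = 0
    rw [map_neg, neg_add_cancel]
  rwa [h0] at h

/-- **Uniqueness**: a path costate of the harmonic chain on `[0, s]` is the harmonic costate
`c_λ(r) = exp((r - s)𝒢) λ` through its terminal value `λ = c(s)`. [folklore] -/
theorem harmonic_pathCostate_eq {T_L T_R s : ℝ} (hs : 0 < s) {z : PhaseSpace N}
    {wp : WienerPair} {c : ℝ → PhaseSpace N} (hc : IsPathCostate ω₂ 0 0 γ N T_L T_R s z wp c) :
    EqOn c (harmCostate ω₂ γ N s (c s)) (Icc 0 s) := by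
  -- the conjugated costate is continuous on `[0, s]` and constant on `(0, s]`, hence on `[0, s]`
  have hG : Continuous fun u : ℝ => exp (u • (-harmCoDriftLin ω₂ γ N)) :=
    continuous_iff_continuousAt.2 fun u =>
      (hasDerivAt_exp_smul_const (𝕂 := ℝ) (-harmCoDriftLin ω₂ γ N) u).continuousAt
  have hecont : ContinuousOn (fun u : ℝ => exp (u • (-harmCoDriftLin ω₂ γ N)) (c u)) (Icc 0 s) :=
    hG.continuousOn.clm_apply hc.1
  have hconst : EqOn (fun u : ℝ => exp (u • (-harmCoDriftLin ω₂ γ N)) (c u))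
      (fun _ => exp (s • (-harmCoDriftLin ω₂ γ N)) (c s)) (Icc 0 s) := by
    have hIoo : EqOn (fun u : ℝ => exp (u • (-harmCoDriftLin ω₂ γ N)) (c u))
        (fun _ => exp (s • (-harmCoDriftLin ω₂ γ N)) (c s)) (Ioo 0 s) := by
      intro a ha
      have h := constant_of_has_deriv_right_zero
        (hecont.mono (Icc_subset_Icc ha.1.le le_rfl))
        (fun x hx => (hasDerivAt_conj_pathCostate ω₂ γ N hc
          ⟨ha.1.trans_le hx.1, hx.2⟩).hasDerivWithinAt) s (right_mem_Icc.2 ha.2.le)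
      exact h.symm
    refine hIoo.of_subset_closure hecont continuousOn_const Ioo_subset_Icc_self ?_
    rw [closure_Ioo hs.ne]
  -- undo the conjugation
  intro r hr
  have h := hconst hr
  simp only at h
  -- `exp` is a one-parameter group on the multiples of `𝒢` (all of them commute and lie in the
  -- disk of convergence of the exponential series over `ℝ`)
  have hball : ∀ x : PhaseSpace N →L[ℝ] PhaseSpace N,
      x ∈ Metric.eball (0 : PhaseSpace N →L[ℝ] PhaseSpace N)
        (expSeries ℝ (PhaseSpace N →L[ℝ] PhaseSpace N)).radius := fun x => by
    rw [expSeries_radius_eq_top, Metric.eball_top_eq_univ]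
    exact mem_univ _
  have hcomm1 : Commute (r • harmCoDriftLin ω₂ γ N) (r • (-harmCoDriftLin ω₂ γ N)) :=
    (((Commute.refl (harmCoDriftLin ω₂ γ N)).neg_right).smul_right r).smul_left r
  have hcomm2 : Commute (r • harmCoDriftLin ω₂ γ N) (s • (-harmCoDriftLin ω₂ γ N)) :=
    (((Commute.refl (harmCoDriftLin ω₂ γ N)).neg_right).smul_right s).smul_left r
  have hinv : exp (r • harmCoDriftLin ω₂ γ N) * exp (r • (-harmCoDriftLin ω₂ γ N)) = 1 := by
    rw [← exp_add_of_commute_of_mem_ball hcomm1 (hball _) (hball _), smul_neg, add_neg_cancel,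
      exp_zero]
  calc c r = (exp (r • harmCoDriftLin ω₂ γ N) * exp (r • (-harmCoDriftLin ω₂ γ N))) (c r) := by
        rw [hinv]
        rfl
    _ = exp (r • harmCoDriftLin ω₂ γ N) (exp (s • (-harmCoDriftLin ω₂ γ N)) (c s)) := by
        rw [← h]
        rfl
    _ = exp (r • harmCoDriftLin ω₂ γ N + s • (-harmCoDriftLin ω₂ γ N)) (c s) := by
        rw [exp_add_of_commute_of_mem_ball hcomm2 (hball _) (hball _)]
        rfl
    _ = harmCostate ω₂ γ N s (c s) r := by
        have hXY : r • harmCoDriftLin ω₂ γ N + s • (-harmCoDriftLin ω₂ γ N) =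
            (r - s) • harmCoDriftLin ω₂ γ N := by
          module
        rw [hXY]
        rfl

end Uniqueness

/-! ## 3. (COF) decided for the harmonic chain -/

section Harmonic

variable {ω₂ γ : ℝ} (hω : 0 < ω₂) (hγ : 0 < γ)

include hω hγ in
/-- **The harmonic calibration of (COF)**: for the harmonic chain `lam = β = 0` (every `N ≥ 2`),
the costate observability floor holds with `μ = 1`, `δ₀ = T` and the `θ`-INDEPENDENT constant
`K = 2N / c₀`, `c₀` the Kalman observability constant of the harmonic costate through the
left-bath momentum on `[0, ½]` (tree `harmonic_costate_observability`): a path costate is the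
harmonic costate through `c(s)` (`harmonic_pathCostate_eq`), its observed energy on `[0, ½]`
is at most that on `[0, s]` (`harmonic_costate_energy_ge`), `⟨c(s), c(s)⟩ ≤ 2N‖c(s)‖²`, and
`Θ_θ ≥ 1`.  So the record leaf beneath (MC∞) is DECIDED in the Gaussian model. [folklore] -/
theorem harmonic_costateObservabilityFloorBody : CostateObservabilityFloorBody ω₂ 0 0 γ := by
  intro T hT N hN
  obtain ⟨c₀, hc₀, hobs⟩ := harmonic_costate_observability ω₂ γ N hN
  have hN0 : (0 : ℝ) < N := by exact_mod_cast (show 0 < N by omega)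
  refine ⟨1, T, one_pos, hT, fun θ hθ => ⟨2 * N / c₀, by positivity, ?_⟩⟩
  intro δ hδ s hs hs1 z wp c hc
  have hs0 : 0 < s := by linarith
  have heq := harmonic_pathCostate_eq ω₂ γ N (T_L := T + δ / 2) (T_R := T - δ / 2) hs0 hc
  -- observability of `c(s)` through `β_0` on `[0, ½] ⊆ [0, s]`
  have hobs' : c₀ * ‖c s‖ ^ 2 ≤ ∫ r in (0 : ℝ)..s, ((c r).2 ⟨0, by omega⟩) ^ 2 := by
    calc c₀ * ‖c s‖ ^ 2
        ≤ ∫ t in (0 : ℝ)..(1 / 2),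
            ((exp (t • (-harmCoDriftLin ω₂ γ N)) (c s)).2 (leftBath N hN)) ^ 2 := hobs (c s)
      _ ≤ ∫ t in (0 : ℝ)..s, ((harmCostate ω₂ γ N s (c s) t).2 (leftBath N hN)) ^ 2 :=
          harmonic_costate_energy_ge ω₂ γ N (leftBath N hN) hs (c s)
      _ = ∫ r in (0 : ℝ)..s, ((c r).2 ⟨0, by omega⟩) ^ 2 := by
          refine intervalIntegral.integral_congr fun r hr => ?_
          rw [uIcc_of_le hs0.le] at hr
          show ((harmCostate ω₂ γ N s (c s) r).2 (leftBath N hN)) ^ 2 = ((c r).2 ⟨0, _⟩) ^ 2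
          rw [← heq hr]
          rfl
  have hI0 : 0 ≤ ∫ r in (0 : ℝ)..s, ((c r).2 ⟨0, by omega⟩) ^ 2 :=
    intervalIntegral.integral_nonneg hs0.le fun r _ => sq_nonneg _
  have hΘ1 : 1 ≤ energyBudget ω₂ 0 0 γ N (T + δ / 2) (T - δ / 2) θ z wp ^ (1 : ℝ) := by
    rw [Real.rpow_one]
    exact one_le_energyBudget hω le_rfl le_rfl hγ.le hθ.le z wp
  calc dualPair (c s) (c s) ≤ 2 * N * ‖c s‖ ^ 2 := dualPair_self_le N (c s)
    _ = 2 * N / c₀ * (c₀ * ‖c s‖ ^ 2) := by field_simp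
    _ ≤ 2 * N / c₀ * ∫ r in (0 : ℝ)..s, ((c r).2 ⟨0, by omega⟩) ^ 2 :=
        mul_le_mul_of_nonneg_left hobs' (by positivity)
    _ = 2 * N / c₀ * 1 * ∫ r in (0 : ℝ)..s, ((c r).2 ⟨0, by omega⟩) ^ 2 := by rw [mul_one]
    _ ≤ 2 * N / c₀ * energyBudget ω₂ 0 0 γ N (T + δ / 2) (T - δ / 2) θ z wp ^ (1 : ℝ) *
          ∫ r in (0 : ℝ)..s, ((c r).2 ⟨0, by omega⟩) ^ 2 :=
        mul_le_mul_of_nonneg_right (mul_le_mul_of_nonneg_left hΘ1 (by positivity)) hI0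

end Harmonic

end Summit.AtomisticToContinuum.FouriersLaw.Theorems.ExtensiveSnapshotIrreversibility.EnergyWindow
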